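import Summits.QuantumFields.YangMills.Theses.BalabanUVNodes
import Summits.QuantumFields.BalabanUV.T4Continuum.Spine.NE7.Targets
import Literature.MathematicalPhysics.QuantumFieldTheory.Balaban1983to89.T4ContinuumYM4Torus

/-!
# `BalabanUVNodes.SpineGivenEndpoint` — DAG node N27 (binder B5, «the nine spine estimates packaged») KNIT BY NAME
# AT THE DATUM: the children N19 · N20 · N21 (+ the U4′ bookkeeping and the E1∕E2 dictionary) as hypotheses under the
# targets' prefix ⇒ `T4ApexHybrid.HybridNE7Under D Hβ`; the K4-guarded form (N19 read as the edge «in-edges ⇒ Core»);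
# faithfulness (the node IS the children's package); and the ∃-currency faces concluding the route item
# `Summit.QuantumFields.YangMills.Theses.BalabanUVNodes.SpineGivenEndpoint` (stmt-QuantumFields-19182).

Cell `pub-ymgap`, HUMAN RULING D-0062 (YM Track A at full width), seat `pub-ymgap-dag-n27-a` (KNIT-BY-NAME seat of DAG
node N27; ROSTER-D0062 row n27; director-ym LINE №12: node N27 files `--supports stmt-QuantumFields-19182`).
Statement of record of N27 (venue `HOME/lean/ym-dag/N27_B5.lean` bbe4e77b3a87323d; YM-PLAN §2d row B5):
`YMDAG.B5 D := T4ApexHybrid.HybridNE7Under D (DagBinding.EndpointExistence D.C.toB12)`, the spine slot of the print-faithful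
headline `T4ContinuumYM4Torus.continuumYM4_torus_of_endpointExistence`, by definition
`D.UnderHypotheses END (fun g₀ => T4ApexHybrid.StringwiseHybridNE7 (D.scheme g₀))` = «(B) → END → for all small `γ`, `g` and
every tuned bare sequence `g₀`, every loop string carries a `T4MatchingAssembly.StringHybridNE7` datum».

WHAT THIS MODULE IS.  The GLUE of a COMPOSITE node, children as hypotheses, at ONE GIVEN datum `D` (no record-predicate
parameter, no world) — complementary to the dagwriter's parametric layer-2 join `YMDAG.UVSplit.B5_at_record (Rec) (Inputs)`
(supply `BalabanUVNodesClusters.lean` 7bd4ce9bbebe80f1, courier dag-p2 per chair R424; its per-string package `SpineDatum D g₀ os`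
is, binder for binder and in the same order, the per-string hypothesis used below, so the two glue layers meet by `Iff.rfl`).
0 `def`, 0 `sorry`, axioms standard; every theorem is [bookkeeping] over tree declarations BY NAME.

THE FIELD-BY-FIELD TABLE (which field of `T4MatchingAssembly.HybridNE7` (T4MatchingAssembly.lean :146) each child fills, its
record decl, and what the tree proves TODAY — 2026-08-25; «at D₀» = at Bałaban's datum of record, NODE 00):
* `weight`   ← N20 = NE7b, `T4WeightBudget.RelWeightBound l₀ T A B Bad W` (:117).  Tree: producers from hypothesis shapes only —
  `T4MatchingAssembly.relWeightBound_of_fibres`, `T4HistoryPeeling.relWeightBound_of_slotDom(_twoRate)`,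
  `T4PeierlsDomination.relWeightBound_of_peierlsDom ∕ _of_posDom`, `T4WeightBudgetKP.relWeightBound_of_polymerDom`,
  `T4MatchingClosure.relWeightBound_of_slotDom_log ∕ _twoRate_log`, `Spine/NE7b/PinnedExtraction.relWeightBound_of_extraction`;
  at D₀: NOT a theorem ((α)-instance 0∕1, NC-NE7b-α unruled).  NOT PRINTED ([Balaban1989LargeFieldII] (1.79)–(1.89) pp. 383–387
  type the renewal factors of ONE run).
* `shell`    ← N21 = NE7c, `T4IndicatorShell.ShellWeightBound l₀ T A B shA shB Wsh` (:403).  Tree: the SHELL-FREE instance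
  `T4MatchingAssembly.shellWeightBound_zero` IS a theorem for any two non-negative term families (design (ii′) «common classifier»);
  fibred ∕ flattened producers `shellWeightBound_of_fibres`, `T4NestedShells.shellWeightBound_of_flattened ∕ _add` from hypothesis
  shapes; at D₀: NOT a theorem (NE7b's species).  NOT PRINTED.
* `lt_one`   ← U4′ bookkeeping `W K + Wsh K < 1`.  Tree: AUTOMATIC IN THE TAIL — `T4MatchingClosure.eventually_budget_lt_one` (two
  summable budgets are eventually `< 1`; `hybridNE7_closure_tail` drops the binder); budget form `T4MatchingAssembly.lt_one_of_lt_exp`.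
* `summable` ← U4′ ∕ node U2 (NE4's scale-shift rate `θ < 1`), `Summable δ`.  Tree: `T4Crossover.summable_crossoverDelta` (from
  `0 < a < 1`, `0 < θ < 1`, the (0.31) lower recursion, `4 < κ₀`), `T4MatchingAssembly.summable_glueDelta` (the head is free),
  `T4MatchingClosure.summable_polyRate_of_kappa ∕ summable_succ_mul_windowSum_log` — theorems GIVEN the rates; the rate letters at D₀
  are N17's (`Spine.NE4.NE4OnData D c θ γ`, 0∕1).
* `core`     ← N19 = NE7 proper, `Summit.QuantumFields.BalabanUV.T4Continuum.Spine.NE7.Core l₀ vol T Bad P Q δ` (Spine/NE7/Targets.lean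
  :71) on the shell-free cores `P = A − shA`, `Q = B − shB`; its PRODUCERS are the six rate children N14 = NE1′
  (`NE1p.DressedRoot.DressedStabilityStrict 𝒯 Λ`), N15 = NE2 (`T4EtaRate.NE2PlusOperator ∧ NE2PlusSite 4 ∧ NE2PlusUnit`), N16 = NE3
  (`NE3EnergyWeightedCovShape.NE3EnergyRateWCov 4 (sfClass 4 L N ε) …`), N17 = NE4 (`Spine.NE4.NE4OnData D c θ γ`), N18 = NE5
  (`T4OutputRate.NE5 EA EB W κ θ C₅`), N22 = NE9 (`T4OutputRate.NE9 E W κ Λ ∧ T4OutputRate.FadingMemory C₉ ω Λ`) through node U3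
  (`T4OutputRate.u3_threeBrackets ∕ u3_geometric`), route 1's road (`NE7Route1EndDocked.goodClause_summable_of_route1_docked`) and the
  faces `Spine.NE7.core_of_pathLeaf` (H1L), `Spine.NE7.CoreOfCountRoad.core_of_countRoadWitness`, `T4MatchingClosure` (`ReindexedBudget`
  ⇒ `GoodClause` ≡ `Core`).  At D₀: NOT a theorem (spine 0∕9); NODE S's averaging-side inputs ARE theorems at the Stage-0 datum of
  record (`Spine.NE7.holDevBound_of_isDatumOfRecord₀`, `loopDefectBound_of_isDatumOfRecord₀`).  NOT PRINTED (printed template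
  [King1986] (3.10)–(3.13) pp. 656–657; why d = 4 needs the relative form: [Balaban1989LargeFieldI] p. 175).
* the dictionary E1∕E2 + `0 < l₀`, `0 < vol`, offset `K₀` (fields of `StringHybridNE7`, T4MatchingAssembly.lean :560): the class sums
  ARE the string's Wilson-normalised dressed partition functions `T4GenFunBounds.schemeZ (D.scheme g₀) os (K₀ + K) t` resp.
  `(K₀ + K + 1)`; tree: `HistoryRealiseCellsRunApex.stringHybridNE7_of_hybridNE7` rescales Bałaban's normalisation into it
  (`exists_const_schemeZ`), GIVEN a `CountRoadWitness`.
ROAD-OF-RECORD WITNESS (YM-PLAN Q8, default in force since 2026-08-26T12:00Z is announced for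
`HistoryRealiseCellsRunApex.hybridNE7Under_of_countRoad`, Support/HistoryRealiseCellsRunApex.lean :322): that road concludes the
LITERAL binder `HybridNE7Under D (BetaPertHyp D.βfun)` (venue `B5lit`), which the form of record IMPLIES
(`T4ContinuumYM4Torus.hybridNE7Under_betaPert_of_endpoint`, anti-monotonicity in the β-binder) and not conversely; the glue below
is stated for an ARBITRARY β-binder `Hβ`, so it serves both forms and any road: a road's END only has to deliver, per tuned run and
string, the children's package (§2) or K4's conclusion and the guarded package (§3).

HONEST FRAMING.  COMPOSITE-node bookkeeping: the hypotheses of §2–§4 ARE the children (by construction the K5 hypothesis is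
«conclusion-shaped» — §4 proves the node is EQUIVALENT to the children's package, so nothing is smuggled and nothing is lost);
NOTHING of Bałaban's is asserted; NO node is discharged here (N27 discharges when N19–N21 do at the carriers of record of D₀, fed
by N14–N18, N22); (B) and the β-binder are antecedents, used, never refuted; one fixed finite four-torus — NOT ℝ⁴, NOT infinite
volume, NOT OS axioms, NOT a mass gap, NOT Clay.  Typed 28∕28 · discharged 0∕28 unchanged by this file.
-/

namespace Summit.QuantumFields.YangMills.Theorems.BalabanUVNodesN27

open Literature.MathematicalPhysics.QuantumFieldTheory.Balaban1983to89
open Literature.MathematicalPhysics.QuantumFieldTheory.Balaban1983to89.T4Continuum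
open Literature.MathematicalPhysics.QuantumFieldTheory.Balaban1983to89.T4WeightBudget (RelWeightBound)
open Literature.MathematicalPhysics.QuantumFieldTheory.Balaban1983to89.T4IndicatorShell (ShellWeightBound)
open Literature.MathematicalPhysics.QuantumFieldTheory.Balaban1983to89.T4MatchingAssembly (HybridNE7 StringHybridNE7)
open Literature.MathematicalPhysics.QuantumFieldTheory.Balaban1983to89.T4ContinuumYM4Torus (ForSmallCouplings)
open Summit.QuantumFields.BalabanUV.T4Continuum.Spine

/-! ## §1 One string of one scheme: the three children at explicit carriers ⇒ `StringHybridNE7` -/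

section Scheme

variable {G : Type*} [GaugeGroup G] [MeasurableSpace G] [HaarData G] {O : Type*}

/-- **ONE STRING, CHILDREN AS HYPOTHESES.**  At explicit term-class carriers (index type `ι`, radius `l₀`, volume letter `vol`,
offset `K₀`, classes `T`, term weights `A`, `B`, shells `shA`, `shB`, bad classes `Bad`, weights `W`, `Wsh`, remainder `δ`):
N20 = NE7b `RelWeightBound` · N21 = NE7c `ShellWeightBound` · N19 = NE7 proper `Spine.NE7.Core` on the shell-free cores · U4′
(`W + Wsh < 1`, `Summable δ`) · the dictionary E1∕E2 against the scheme's dressed partition functions of the string `os` from `K₀`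
on ⇒ the per-string hybrid-NE7 datum `T4MatchingAssembly.StringHybridNE7 S os l₀ vol K₀` — `Spine.NE7.hybridNE7_of_core` BY NAME,
then packaging.  [bookkeeping] [folklore] -/
theorem stringHybridNE7_of_spineNodes (S : Missing.TorusScheme G O) (os : List O) {l₀ vol : ℝ} {K₀ : ℕ}
    {ι : Type} [DecidableEq ι] {T : ℕ → Finset ι} {A B shA shB : ℕ → ℝ → ι → ℝ} {Bad : ℕ → ℝ → Finset ι}
    {W Wsh δ : ℕ → ℝ}
    (h20 : RelWeightBound l₀ T A B Bad W) (h21 : ShellWeightBound l₀ T A B shA shB Wsh)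
    (h19 : NE7.Core l₀ vol T Bad (fun K t τ => A K t τ - shA K t τ) (fun K t τ => B K t τ - shB K t τ) δ)
    (hlt : ∀ K, W K + Wsh K < 1) (hδ : Summable δ)
    (hE1 : ∀ (K : ℕ) (t : ℝ), |t| ≤ l₀ → T4GenFunBounds.schemeZ S os (K₀ + K) t = ∑ τ ∈ T K, A K t τ)
    (hE2 : ∀ (K : ℕ) (t : ℝ), |t| ≤ l₀ → T4GenFunBounds.schemeZ S os (K₀ + K + 1) t = ∑ τ ∈ T K, B K t τ) :
    StringHybridNE7 S os l₀ vol K₀ :=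
  ⟨ι, ‹_›, T, A, B, shA, shB, Bad, W, Wsh, δ, NE7.hybridNE7_of_core h20 h21 hlt hδ h19, hE1, hE2⟩

/-- Conversely a per-string hybrid-NE7 datum EXHIBITS carriers at which the three children, U4′ and E1∕E2 hold (structure
projections; `Spine.NE7.core_of_hybridNE7`) — the package loses nothing.  [bookkeeping] [folklore] -/
theorem spineNodes_of_stringHybridNE7 (S : Missing.TorusScheme G O) (os : List O) {l₀ vol : ℝ} {K₀ : ℕ}
    (h : StringHybridNE7 S os l₀ vol K₀) :
    ∃ (ι : Type) (_ : DecidableEq ι) (T : ℕ → Finset ι) (A B shA shB : ℕ → ℝ → ι → ℝ) (Bad : ℕ → ℝ → Finset ι)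
      (W Wsh δ : ℕ → ℝ),
      RelWeightBound l₀ T A B Bad W ∧ ShellWeightBound l₀ T A B shA shB Wsh ∧
        NE7.Core l₀ vol T Bad (fun K t τ => A K t τ - shA K t τ) (fun K t τ => B K t τ - shB K t τ) δ ∧
        (∀ K, W K + Wsh K < 1) ∧ Summable δ ∧
        (∀ (K : ℕ) (t : ℝ), |t| ≤ l₀ → T4GenFunBounds.schemeZ S os (K₀ + K) t = ∑ τ ∈ T K, A K t τ) ∧
        (∀ (K : ℕ) (t : ℝ), |t| ≤ l₀ → T4GenFunBounds.schemeZ S os (K₀ + K + 1) t = ∑ τ ∈ T K, B K t τ) := by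
  obtain ⟨ι, _, T, A, B, shA, shB, Bad, W, Wsh, δ, hH, hE1, hE2⟩ := h
  exact ⟨ι, ‹_›, T, A, B, shA, shB, Bad, W, Wsh, δ, hH.weight, hH.shell, NE7.core_of_hybridNE7 hH, hH.lt_one, hH.summable,
    hE1, hE2⟩

end Scheme

/-! ## §2 THE N27 GLUE AT THE DATUM: the children's package under the targets' prefix ⇒ `HybridNE7Under D Hβ` -/

section Datum

variable {F : T4Family} {G : Type*} [GaugeGroup G] [MeasurableSpace G] [HaarData G]

/-- **N27 = B5 AT THE DATUM, CHILDREN AS HYPOTHESES (any finite-`ε` datum `D`, any β-binder `Hβ`).**  If, under the targets'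
prefix (`D.UnderHypotheses Hβ`: (B) pinned → `Hβ` → for all small `γ`, `g` and every tuned bare sequence `g₀`), every loop string
`os` carries term-class carriers with `0 < l₀`, `0 < vol` at which N20 (`RelWeightBound`), N21 (`ShellWeightBound`), N19
(`Spine.NE7.Core` on the shell-free cores), the U4′ bookkeeping and the E1∕E2 dictionary against
`T4GenFunBounds.schemeZ (D.scheme g₀) os` hold — verbatim the dagwriter's `YMDAG.UVSplit.SpineDatum D g₀ os` — then the spine slot
`T4ApexHybrid.HybridNE7Under D Hβ` holds.  With `Hβ := DagBinding.EndpointExistence D.C.toB12` the conclusion is the venue's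
`YMDAG.B5 D` (form of record); with `Hβ := BetaPertHyp D.βfun` it is `YMDAG.B5lit D`.  `UnderHypotheses.mono` + §1. [bookkeeping]
[folklore] -/
theorem hybridNE7Under_of_spineNodes (D : FiniteEpsData F G) {Hβ : Prop}
    (h : D.UnderHypotheses Hβ fun g₀ => ∀ os : List (ULoop F),
      ∃ (ι : Type) (_ : DecidableEq ι) (l₀ vol : ℝ) (K₀ : ℕ) (T : ℕ → Finset ι) (A B shA shB : ℕ → ℝ → ι → ℝ)
        (Bad : ℕ → ℝ → Finset ι) (W Wsh δ : ℕ → ℝ),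
        0 < l₀ ∧ 0 < vol ∧
          RelWeightBound l₀ T A B Bad W ∧
          ShellWeightBound l₀ T A B shA shB Wsh ∧
          NE7.Core l₀ vol T Bad (fun K t τ => A K t τ - shA K t τ) (fun K t τ => B K t τ - shB K t τ) δ ∧
          (∀ K, W K + Wsh K < 1) ∧ Summable δ ∧
          (∀ K t, |t| ≤ l₀ → T4GenFunBounds.schemeZ (D.scheme g₀) os (K₀ + K) t = ∑ τ ∈ T K, A K t τ) ∧
          (∀ K t, |t| ≤ l₀ → T4GenFunBounds.schemeZ (D.scheme g₀) os (K₀ + K + 1) t = ∑ τ ∈ T K, B K t τ)) :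
    T4ApexHybrid.HybridNE7Under D Hβ :=
  FiniteEpsData.UnderHypotheses.mono (fun g₀ hg os => by
    obtain ⟨ι, _, l₀, vol, K₀, T, A, B, shA, shB, Bad, W, Wsh, δ, hl₀, hvol, h20, h21, h19, hlt, hδ, hE1, hE2⟩ := hg os
    exact ⟨l₀, vol, K₀, hl₀, hvol, stringHybridNE7_of_spineNodes (D.scheme g₀) os h20 h21 h19 hlt hδ hE1 hE2⟩) h

/-- **FAITHFULNESS: THE NODE IS THE CHILDREN'S PACKAGE.**  `T4ApexHybrid.HybridNE7Under D Hβ` is EQUIVALENT to the hypothesis of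
`hybridNE7Under_of_spineNodes` — the composite binder B5 says nothing beyond N19 ∧ N20 ∧ N21 ∧ U4′ ∧ E1∕E2 at some carriers per
string under the prefix (so the glue is conclusion-shaped by construction and smuggles nothing).  [bookkeeping] [folklore] -/
theorem hybridNE7Under_iff_spineNodes (D : FiniteEpsData F G) (Hβ : Prop) :
    T4ApexHybrid.HybridNE7Under D Hβ ↔ D.UnderHypotheses Hβ fun g₀ => ∀ os : List (ULoop F),
      ∃ (ι : Type) (_ : DecidableEq ι) (l₀ vol : ℝ) (K₀ : ℕ) (T : ℕ → Finset ι) (A B shA shB : ℕ → ℝ → ι → ℝ)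
        (Bad : ℕ → ℝ → Finset ι) (W Wsh δ : ℕ → ℝ),
        0 < l₀ ∧ 0 < vol ∧
          RelWeightBound l₀ T A B Bad W ∧
          ShellWeightBound l₀ T A B shA shB Wsh ∧
          NE7.Core l₀ vol T Bad (fun K t τ => A K t τ - shA K t τ) (fun K t τ => B K t τ - shB K t τ) δ ∧
          (∀ K, W K + Wsh K < 1) ∧ Summable δ ∧
          (∀ K t, |t| ≤ l₀ → T4GenFunBounds.schemeZ (D.scheme g₀) os (K₀ + K) t = ∑ τ ∈ T K, A K t τ) ∧
          (∀ K t, |t| ≤ l₀ → T4GenFunBounds.schemeZ (D.scheme g₀) os (K₀ + K + 1) t = ∑ τ ∈ T K, B K t τ) := by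
  refine ⟨fun h => FiniteEpsData.UnderHypotheses.mono (fun g₀ hg os => ?_) h, hybridNE7Under_of_spineNodes D⟩
  obtain ⟨l₀, vol, K₀, hl₀, hvol, hS⟩ := hg os
  obtain ⟨ι, _, T, A, B, shA, shB, Bad, W, Wsh, δ, h20, h21, h19, hlt, hδ, hE1, hE2⟩ :=
    spineNodes_of_stringHybridNE7 (D.scheme g₀) os hS
  exact ⟨ι, ‹_›, l₀, vol, K₀, T, A, B, shA, shB, Bad, W, Wsh, δ, hl₀, hvol, h20, h21, h19, hlt, hδ, hE1, hE2⟩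

/-! ## §3 The K4-guarded form: N19 read as the EDGE «in-edges ⇒ Core», K4's conclusion consumed -/

/-- **N27 FROM K4 «SpineRates» AND K5 «SpineMatching» AT THE DATUM (the shape of `YMDAG.UVSplit.B5_at_record`, at one datum).**
`Inputs g₀ os` is cluster K4's conclusion for the string — «the six in-edges of N19 (N14 NE1′ `DressedStabilityStrict`, N15 NE2
`NE2PlusOperator ∧ NE2PlusSite ∧ NE2PlusUnit`, N16 NE3 `NE3EnergyRateWCov`, N17 NE4 `NE4OnData D`, N18 NE5 `T4OutputRate.NE5`, N22 NE9
`T4OutputRate.NE9 ∧ FadingMemory`) hold at their carriers of record for `(D, g₀, os)`»; its by-name instantiation is the dagwriter's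
`RateInputs RRec` (supply `BalabanUVNodesSpineRates.lean` 04f3f9512bcf66e0), kept ABSTRACT here because at Stage 0 no reading predicate
of the rate carriers off `D` exists (NODE 00 Stage 5).  Hypotheses: `h4` = K4's conclusion under the prefix; `h5` = K5 GUARDED by it
(the children's package GIVEN the in-edges).  The two prefixes are conjoined at the smaller thresholds (`ForSmallCouplings.and`), modus
ponens per string, then §2 — so K4 IS CONSUMED.  [bookkeeping] [folklore] -/
theorem hybridNE7Under_of_spineRates_spineMatching (D : FiniteEpsData F G) {Hβ : Prop}
    (Inputs : (ℕ → ℝ) → List (ULoop F) → Prop)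
    (h4 : D.UnderHypotheses Hβ fun g₀ => ∀ os : List (ULoop F), Inputs g₀ os)
    (h5 : D.UnderHypotheses Hβ fun g₀ => ∀ os : List (ULoop F), Inputs g₀ os →
      ∃ (ι : Type) (_ : DecidableEq ι) (l₀ vol : ℝ) (K₀ : ℕ) (T : ℕ → Finset ι) (A B shA shB : ℕ → ℝ → ι → ℝ)
        (Bad : ℕ → ℝ → Finset ι) (W Wsh δ : ℕ → ℝ),
        0 < l₀ ∧ 0 < vol ∧
          RelWeightBound l₀ T A B Bad W ∧
          ShellWeightBound l₀ T A B shA shB Wsh ∧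
          NE7.Core l₀ vol T Bad (fun K t τ => A K t τ - shA K t τ) (fun K t τ => B K t τ - shB K t τ) δ ∧
          (∀ K, W K + Wsh K < 1) ∧ Summable δ ∧
          (∀ K t, |t| ≤ l₀ → T4GenFunBounds.schemeZ (D.scheme g₀) os (K₀ + K) t = ∑ τ ∈ T K, A K t τ) ∧
          (∀ K t, |t| ≤ l₀ → T4GenFunBounds.schemeZ (D.scheme g₀) os (K₀ + K + 1) t = ∑ τ ∈ T K, B K t τ)) :
    T4ApexHybrid.HybridNE7Under D Hβ := by
  refine hybridNE7Under_of_spineNodes D fun hB hβ => ?_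
  have h4' : ForSmallCouplings D fun g₀ => ∀ os : List (ULoop F), Inputs g₀ os := h4 hB hβ
  have h5' := h5 hB hβ
  exact (h4'.and h5').mono fun g₀ hg os => hg.2 os (hg.1 os)

end Datum

/-! ## §4 The route-item faces (∃-currency of route «BalabanUVNodes», `N = 2`, Stage-0 datum of record) -/

section Route

open Summit.QuantumFields.YangMills.Theses.BalabanUVNodes (SpineGivenEndpoint)

/-- **THE RUNG FROM THE NODE: `SpineGivenEndpoint` ⇐ «at some Stage-0 datum of record with (B) pinned and endpoint existence,
for all small couplings every string carries the children's package (N19 ∧ N20 ∧ N21 ∧ U4′ ∧ E1∕E2)».**  The hypothesis is the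
item's own ∃ → ∃ currency (BC3 skeleton `SpineGivenEndpoint_birth.lean` a8ed52bc3da1a747: `stub_classExpansionAtRecord` +
`stub_coreMatchingAtRecord` deliver exactly this, their `HasCoreMatching` unpacking to the package); the conclusion's datum IS the
hypothesis' output datum (no witness switch inside this theorem).  §2 at `Hβ := EndpointExistence`.  [bookkeeping] [folklore] -/
theorem spineGivenEndpoint_of_spineNodesAtRecord
    (h : ∀ F : T4Family,
      (∃ D : FiniteEpsData F (Matrix.specialUnitaryGroup (Fin 2) ℂ),
          Node00.IsDatumOfRecord₀ F 2 D ∧ B16.EndStatementBPrinted D.C ∧ DagBinding.EndpointExistence D.C.toB12) →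
        ∃ D : FiniteEpsData F (Matrix.specialUnitaryGroup (Fin 2) ℂ),
          Node00.IsDatumOfRecord₀ F 2 D ∧ B16.EndStatementBPrinted D.C ∧ DagBinding.EndpointExistence D.C.toB12 ∧
            ForSmallCouplings D fun g₀ => ∀ os : List (ULoop F),
              ∃ (ι : Type) (_ : DecidableEq ι) (l₀ vol : ℝ) (K₀ : ℕ) (T : ℕ → Finset ι) (A B shA shB : ℕ → ℝ → ι → ℝ)
                (Bad : ℕ → ℝ → Finset ι) (W Wsh δ : ℕ → ℝ),
                0 < l₀ ∧ 0 < vol ∧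
                  RelWeightBound l₀ T A B Bad W ∧
                  ShellWeightBound l₀ T A B shA shB Wsh ∧
                  NE7.Core l₀ vol T Bad (fun K t τ => A K t τ - shA K t τ) (fun K t τ => B K t τ - shB K t τ) δ ∧
                  (∀ K, W K + Wsh K < 1) ∧ Summable δ ∧
                  (∀ K t, |t| ≤ l₀ → T4GenFunBounds.schemeZ (D.scheme g₀) os (K₀ + K) t = ∑ τ ∈ T K, A K t τ) ∧
                  (∀ K t, |t| ≤ l₀ →
                    T4GenFunBounds.schemeZ (D.scheme g₀) os (K₀ + K + 1) t = ∑ τ ∈ T K, B K t τ)) :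
    SpineGivenEndpoint := by
  intro F hF
  obtain ⟨D, h0, hB, hE, hS⟩ := h F hF
  exact ⟨D, h0, hB, hE, hybridNE7Under_of_spineNodes D fun _ _ => hS⟩

/-- **THE RUNG FROM K4 AND K5 (∃-currency, N19 as the edge).**  `Inputs F D g₀ os` = cluster K4's conclusion for the string (the six
in-edges of N19 at their carriers of record; by name = the dagwriter's `RateInputs RRec`).  `h4` : at some Stage-0 datum of record with
(B) and END, K4's conclusion holds for all small couplings; `h5` : at any such datum carrying K4's conclusion, the GUARDED children's
package holds for all small couplings (K5).  Then `SpineGivenEndpoint` — §3 at `Hβ := EndpointExistence`; K4 consumed.  [bookkeeping]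
[folklore] -/
theorem spineGivenEndpoint_of_spineRates_spineMatching
    (Inputs : ∀ F : T4Family, FiniteEpsData F (Matrix.specialUnitaryGroup (Fin 2) ℂ) → (ℕ → ℝ) → List (ULoop F) → Prop)
    (h4 : ∀ F : T4Family,
      (∃ D : FiniteEpsData F (Matrix.specialUnitaryGroup (Fin 2) ℂ),
          Node00.IsDatumOfRecord₀ F 2 D ∧ B16.EndStatementBPrinted D.C ∧ DagBinding.EndpointExistence D.C.toB12) →
        ∃ D : FiniteEpsData F (Matrix.specialUnitaryGroup (Fin 2) ℂ),
          Node00.IsDatumOfRecord₀ F 2 D ∧ B16.EndStatementBPrinted D.C ∧ DagBinding.EndpointExistence D.C.toB12 ∧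
            ForSmallCouplings D fun g₀ => ∀ os : List (ULoop F), Inputs F D g₀ os)
    (h5 : ∀ (F : T4Family) (D : FiniteEpsData F (Matrix.specialUnitaryGroup (Fin 2) ℂ)),
      Node00.IsDatumOfRecord₀ F 2 D → B16.EndStatementBPrinted D.C → DagBinding.EndpointExistence D.C.toB12 →
        (ForSmallCouplings D fun g₀ => ∀ os : List (ULoop F), Inputs F D g₀ os) →
          ForSmallCouplings D fun g₀ => ∀ os : List (ULoop F), Inputs F D g₀ os →
            ∃ (ι : Type) (_ : DecidableEq ι) (l₀ vol : ℝ) (K₀ : ℕ) (T : ℕ → Finset ι) (A B shA shB : ℕ → ℝ → ι → ℝ)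
              (Bad : ℕ → ℝ → Finset ι) (W Wsh δ : ℕ → ℝ),
              0 < l₀ ∧ 0 < vol ∧
                RelWeightBound l₀ T A B Bad W ∧
                ShellWeightBound l₀ T A B shA shB Wsh ∧
                NE7.Core l₀ vol T Bad (fun K t τ => A K t τ - shA K t τ) (fun K t τ => B K t τ - shB K t τ) δ ∧
                (∀ K, W K + Wsh K < 1) ∧ Summable δ ∧
                (∀ K t, |t| ≤ l₀ → T4GenFunBounds.schemeZ (D.scheme g₀) os (K₀ + K) t = ∑ τ ∈ T K, A K t τ) ∧
                (∀ K t, |t| ≤ l₀ →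
                  T4GenFunBounds.schemeZ (D.scheme g₀) os (K₀ + K + 1) t = ∑ τ ∈ T K, B K t τ)) :
    SpineGivenEndpoint := by
  intro F hF
  obtain ⟨D, h0, hB, hE, hK4⟩ := h4 F hF
  exact ⟨D, h0, hB, hE, hybridNE7Under_of_spineRates_spineMatching D (Inputs F D) (fun _ _ => hK4)
    fun _ _ => h5 F D h0 hB hE hK4⟩

/-- **… AND CONVERSELY the rung's conclusion EXHIBITS the children's package** at its datum, for all small couplings (§2 faithfulness,
modus ponens with (B) and END) — the ∃-currency rung and «N27's children at some datum of record» are the same statement.  [bookkeeping]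
[folklore] -/
theorem spineNodesAtRecord_of_rung {F : T4Family} {D : FiniteEpsData F (Matrix.specialUnitaryGroup (Fin 2) ℂ)}
    (hB : B16.EndStatementBPrinted D.C) (hE : DagBinding.EndpointExistence D.C.toB12)
    (hNE : T4ApexHybrid.HybridNE7Under D (DagBinding.EndpointExistence D.C.toB12)) :
    ForSmallCouplings D fun g₀ => ∀ os : List (ULoop F),
      ∃ (ι : Type) (_ : DecidableEq ι) (l₀ vol : ℝ) (K₀ : ℕ) (T : ℕ → Finset ι) (A B shA shB : ℕ → ℝ → ι → ℝ)
        (Bad : ℕ → ℝ → Finset ι) (W Wsh δ : ℕ → ℝ),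
        0 < l₀ ∧ 0 < vol ∧
          RelWeightBound l₀ T A B Bad W ∧
          ShellWeightBound l₀ T A B shA shB Wsh ∧
          NE7.Core l₀ vol T Bad (fun K t τ => A K t τ - shA K t τ) (fun K t τ => B K t τ - shB K t τ) δ ∧
          (∀ K, W K + Wsh K < 1) ∧ Summable δ ∧
          (∀ K t, |t| ≤ l₀ → T4GenFunBounds.schemeZ (D.scheme g₀) os (K₀ + K) t = ∑ τ ∈ T K, A K t τ) ∧
          (∀ K t, |t| ≤ l₀ → T4GenFunBounds.schemeZ (D.scheme g₀) os (K₀ + K + 1) t = ∑ τ ∈ T K, B K t τ) :=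
  (hybridNE7Under_iff_spineNodes D _).mp hNE hB hE

end Route

/-! ## §5 The β-side in-edge of the road of record: two-sided box bounds, not `BetaPertHyp` -/

section BoxBounds

variable {F : T4Family} {G : Type*} [GaugeGroup G] [MeasurableSpace G] [HaarData G]

/-- **THE ROAD'S β-SIDE IN-EDGE, NAMED.**  The Q8 default road (`HistoryRealiseCellsRunApex.hybridNE7Under_of_countRoad`) consumes its
β-binder `BetaPertHyp D.βfun` ONLY through the two-sided box bounds `b ≤ β_{k+1} ≤ β′` on the boxes `]0, γ₀]^{k+1}`, `0 < b ≤ β′`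
(`HistoryFlow.boxBounds_of_betaPertHyp` → `flowSide_of_betaPertHyp`): [Balaban1987RG1] (1.22) p. 264, upper half «uniformly bounded on
this interval» (proof deferred in print), lower half = discrete asymptotic freedom (printed nowhere; census T09.F).  At the datum of record
these are B2's β-side ∕ the (D1)-chain outputs (cluster K3's `S_BetaSide` in run currency, `DagBinding.BetaBoundsInInterval`), NOT
consequences of endpoint existence — so they are an IN-EDGE of N27's road in the form of record.  Kernel face: if a road delivers the
children's package under the BOX-BOUNDS binder and the box bounds are theorems at `D`, the spine slot holds under EVERY β-binder `Hβ` —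
N27's form of record (`Hβ := DagBinding.EndpointExistence D.C.toB12`) as well as the literal `B5lit` (`Hβ := BetaPertHyp D.βfun`, itself
RIGID: `BetaPertRigid.not_betaPertH_of_two_scales`).  `UnderHypotheses.of_imp` + §2.  [bookkeeping] [folklore] -/
theorem hybridNE7Under_of_spineNodes_boxBounds (D : FiniteEpsData F G) {Hβ : Prop}
    (hbb : ∃ γ₀ b β' : ℝ, 0 < γ₀ ∧ 0 < b ∧ b ≤ β' ∧ FlowStep.BetaLowerH b γ₀ D.βfun ∧ FlowStep.BetaUpperH β' γ₀ D.βfun)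
    (h : D.UnderHypotheses
      (∃ γ₀ b β' : ℝ, 0 < γ₀ ∧ 0 < b ∧ b ≤ β' ∧ FlowStep.BetaLowerH b γ₀ D.βfun ∧ FlowStep.BetaUpperH β' γ₀ D.βfun)
      fun g₀ => ∀ os : List (ULoop F),
        ∃ (ι : Type) (_ : DecidableEq ι) (l₀ vol : ℝ) (K₀ : ℕ) (T : ℕ → Finset ι) (A B shA shB : ℕ → ℝ → ι → ℝ)
          (Bad : ℕ → ℝ → Finset ι) (W Wsh δ : ℕ → ℝ),
          0 < l₀ ∧ 0 < vol ∧
            RelWeightBound l₀ T A B Bad W ∧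
            ShellWeightBound l₀ T A B shA shB Wsh ∧
            NE7.Core l₀ vol T Bad (fun K t τ => A K t τ - shA K t τ) (fun K t τ => B K t τ - shB K t τ) δ ∧
            (∀ K, W K + Wsh K < 1) ∧ Summable δ ∧
            (∀ K t, |t| ≤ l₀ → T4GenFunBounds.schemeZ (D.scheme g₀) os (K₀ + K) t = ∑ τ ∈ T K, A K t τ) ∧
            (∀ K t, |t| ≤ l₀ → T4GenFunBounds.schemeZ (D.scheme g₀) os (K₀ + K + 1) t = ∑ τ ∈ T K, B K t τ)) :
    T4ApexHybrid.HybridNE7Under D Hβ :=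
  hybridNE7Under_of_spineNodes D (h.of_imp fun _ => hbb)

/-- … whereas a road delivering the LITERAL binder's shape (`Hβ := BetaPertHyp D.βfun`, the Q8 default's conclusion `B5lit`) gives the
form of record only TOGETHER WITH `BetaPertHyp D.βfun` at `D` (anti-monotonicity `T4ApexHybrid.HybridNE7Under.of_imp`; the other direction
`T4ContinuumYM4Torus.hybridNE7Under_betaPert_of_endpoint` is free).  Recorded to make the asymmetry visible by name; the box-bounds face
above is the one to use (the literal binder is rigid).  [bookkeeping] [folklore] -/
theorem hybridNE7Under_of_literal (D : FiniteEpsData F G) {Hβ : Prop} (hβ : BetaPertHyp D.βfun)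
    (h : T4ApexHybrid.HybridNE7Under D (BetaPertHyp D.βfun)) : T4ApexHybrid.HybridNE7Under D Hβ :=
  T4ApexHybrid.HybridNE7Under.of_imp (fun _ => hβ) h

end BoxBounds

end Summit.QuantumFields.YangMills.Theorems.BalabanUVNodesN27
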